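import Literature.AlgebraicGeometry.Motives.HodgeStructureLefschetzGroupEigenspaceSplitting
import Mathlib.RingTheory.AlgebraTower
import HarnessLib

/-!
# Milne 1999, Proposition 2.1 on points: the blocks `V_{K,σ}` of `K ⊗ V = ⊕_σ V_{K,σ}` all have dimension
# `dim_ℚ V / [F : ℚ]`, and `K ⊗_ℚ V` is free of that rank over `K ⊗_ℚ F` for EVERY field `K ⊇ ℚ`

[topic AlgebraicGeometry/Motives]

Layer `Literature/AlgebraicGeometry/Motives`, lane `lit-hodgefound` (Track 2 foundations library; seat `lit-hodgefound-p34`,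
generation 20, FILE 2 of the self-proposed row g20-#2; sequel of `Motives/HodgeStructureLefschetzGroupEigenspaceSplitting`
(the blocks `V_{K,σ} = A.eigenspaceBaseChange K σ`, their projectors `πₛ` and the decomposition `K ⊗ V = ⊕ₛ V_{K,τₛ}`)).
THEOREMS ONLY (no definition, no named fact; net debt `0`).

CARRIER. `H : HodgeStructure V n`, a number field `F` acting by Hodge endomorphisms `A : EndAction H F`
(`ι : F →ₐ[ℚ] End_ℚ V`); a field `K ⊇ ℚ`; where the decomposition is used, an injective family `τ : S → (F →ₐ[ℚ] K)` with
`card S = [F : ℚ]` (Milne's `k^al`). `V` is an `F`-vector space through `ι` (`Module.compHom`, inside proofs only; its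
`F`-dimension is `d = dim_ℚ V / [F : ℚ]`).

## The source, verbatim

J. S. Milne, *Lefschetz classes on abelian varieties*, Duke Math. J. **96** (1999) 639–675 [Milne1999LefschetzClasses]
(held `paper:doi-10-1215-s0012-7094-99-09620-5`; Duke page = folio + 638), §2 p. 646 (p0008) L49: "Proposition 2.1 below
shows that `Vᵢ` has dimension `2g/f` over `Fᵢ`." p. 647 (p0009) L14–L33: "**Proposition 2.1.** Let `A` be an abelian
variety, and let `L` be a subfield of `End⁰(A)` containing the identity map. Then `V(A)` is a free `L ⊗_ℚ k`-module of
rank `2 dim A/[L : ℚ]`. Proof. If `L ⊗_ℚ k` is again a field, then there is nothing to prove. In general it will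
decompose into a product of fields `L ⊗_ℚ k = ∏ Lᵢ` and correspondingly `V(A) ≈ ⊕ Lᵢ^{mᵢ}`, some `mᵢ ≥ 0`, as an
`L ⊗_ℚ k`-module. Our task is to show that the `mᵢ` are all equal (in fact, to `2 dim A/[L : ℚ]`). […] It follows that
`P_{A,α}(X) = P_{L/ℚ,α}(X)^m` for some integer `m` and that each `mᵢ = m`. On equating the degrees, we find that
`2 dim A = m[L : ℚ]`." p. 649 (p0011) L1–L8: "`(V_σ, φ_σ) = (V(A), φ) ⊗_{F,σ} k^al`". Deligne, LNM 900 §4 (re-ed. p. 30):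
"Each `H¹_{B,σ}` has dimension `d`" (`d = dim_E H¹`).

## What is PROVED (and how it differs from the printed proof)

Milne works with an arbitrary Weil cohomology, where `V(A)` has no `ℚ`-structure, and must use the rationality of the
characteristic polynomial. On the present carrier `k = ℚ` and `V(A) = V` IS an `F`-vector space through `ι`, so the
rank statement is elementary; what we prove is its reading on the points in a field `K`:

* §6 for a SPLIT `K` (hypotheses `hτ`, `hcard`): `finrank_field_dvd_finrank` (`[F:ℚ] ∣ dim_ℚ V`, "`2 dim A = m[L : ℚ]`");
  `finrank_eigenspaceBaseChange_le` (each block is `K`-spanned by the `d` vectors `πₛ(1 ⊗ vⱼ)`, `(vⱼ)` an `F`-basis of `V`,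
  since `πₛ(1 ⊗ b v) = τₛ(b) πₛ(1 ⊗ v)`); `sum_finrank_eigenspaceBaseChange` (`Σₛ dim V_{K,τₛ} = dim_ℚ V`, from
  `isInternal_eigenspaceBaseChange` and `finrank_baseChange`); hence **`finrank_eigenspaceBaseChange_eq_div` /
  `_mul_finrank`: `dim_K V_{K,σ} = dim_ℚ V / [F : ℚ]` for every `σ`** ("`Vᵢ` has dimension `2g/f` over `Fᵢ`", "Each
  `H¹_{B,σ}` has dimension `d`" — the tree's `EndAction.finrank_iInf_eigenspace_eq_div` is the case `K = ℂ`, proved there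
  through the canonical embedding; here any split `K`, by counting); and `eigenspaceBaseChange_eq_span_eigenprojBaseChange_one_tmul`
  (`V_{K,σ}` is the `K`-span of `πσ(1 ⊗ V)`: "`V_σ = V(A) ⊗_{F,σ} k^al`").
* §7 for EVERY field `K ⊇ ℚ` (no splitting): **`exists_bijective_sum_baseChange_apply_ι`** — there are `d` vectors
  `vⱼ ∈ V` with `d · [F:ℚ] = dim_ℚ V` such that `(cⱼ) ↦ Σⱼ (k ⊗ b ↦ k ⊗ ι(b) vⱼ)(cⱼ)` is a `K`-linear bijection
  `(K ⊗_ℚ F)^d → K ⊗_ℚ V`, which by `baseChange_apply_ι_comp_mul` intertwines multiplication by `1 ⊗ a` with `ι(a)_K`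
  — "`V(A)` is a free `L ⊗_ℚ k`-module of rank `2 dim A/[L : ℚ]`" for `L = F`, `k = K`; plus the plumbing
  `finrank_eq_sum_of_isInternal` (dimension of an internal direct sum) and `baseChange_ι_comm`.

NOT here: Milne's characteristic-polynomial argument itself (not needed over `k = ℚ`); the module structure of `K ⊗ V`
over the RING `K ⊗_ℚ F` as a Mathlib `Module` instance (the tree reads it through `ι_K`, cf. `baseChangeAction` of
`Motives/HodgeStructureLefschetzGroupTraceTransfer`, BY NAME); non-split intermediate fields `Fᵢ ≠ K`.

## References

* [Milne1999LefschetzClasses] J. S. Milne, *Lefschetz classes on abelian varieties*, Duke Math. J. 96 (1999) 639–675, §2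
  Prop. 2.1 (p. 647) and p. 646 L49, p. 649 L1–L8.
* [Deligne1982HodgeCycles] P. Deligne, *Hodge cycles on abelian varieties*, LNM 900 (1982), §4, proof of Prop. 4.4
  ("Each `H¹_{B,σ}` has dimension `d`").
-/

noncomputable section

open scoped TensorProduct

namespace Literature.AlgebraicGeometry.Motives

namespace HodgeStructure

universe u uK

variable {V : Type u} [AddCommGroup V] [Module ℚ V] {n : ℤ} {H : HodgeStructure V n}
variable {F : Type*} [Field F] [NumberField F]
variable (K : Type uK) [Field K] [Algebra ℚ K] (A : EndAction H F) {S : Type*} (τ : S → (F →ₐ[ℚ] K))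

/-! ## §6 Proposition 2.1 on points: every block `V_{K,σ}` has dimension `dim_ℚ V / [F : ℚ]` -/

namespace EndAction

section Dimension

open Module

omit [Algebra ℚ K] in
/-- The dimension of an internal direct sum is the sum of the dimensions (collected basis). [folklore]
[cite: Milne1999LefschetzClasses, §2 Prop. 2.1 (proof: "On equating the degrees")] -/
theorem finrank_eq_sum_of_isInternal {ι : Type*} [Fintype ι] [DecidableEq ι] {M : Type*} [AddCommGroup M]
    [Module K M] [FiniteDimensional K M] {W : ι → Submodule K M} (h : DirectSum.IsInternal W) :
    finrank K M = ∑ i, finrank K (W i) := by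
  let b := h.collectedBasis fun i => Module.finBasis K (W i)
  rw [Module.finrank_eq_card_basis b, Fintype.card_sigma]
  simp

/-- **`[F : ℚ]` divides `dim_ℚ V`** (`V` is an `F`-vector space through `ι`; `dim_ℚ V = [F:ℚ] · dim_F V`) — Milne's
"`2 dim A = m[L : ℚ]`". [cite: Milne1999LefschetzClasses, §2 Prop. 2.1 (proof, "2 dim A = m[L : ℚ]")] -/
theorem finrank_field_dvd_finrank (A : EndAction H F) [Module.Finite ℚ V] : finrank ℚ F ∣ finrank ℚ V := by
  letI : Module F V := Module.compHom V (A.ι : F →+* Module.End ℚ V)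
  haveI : IsScalarTower ℚ F V := A.isScalarTower_compHom
  exact ⟨finrank F V, (Module.finrank_mul_finrank ℚ F V).symm⟩

/-- `ι(b)_K` commutes with every `ι(a)_K` (`F` is commutative), hence with the projectors and preserves the blocks.
[cite: Milne1999LefschetzClasses, §2 p. 646 L50–L52] -/
theorem baseChange_ι_comm (a b : F) (x : K ⊗[ℚ] V) :
    (A.ι b).baseChange K ((A.ι a).baseChange K x) = (A.ι a).baseChange K ((A.ι b).baseChange K x) := by
  rw [← LinearMap.comp_apply, ← LinearMap.baseChange_comp, ← Module.End.mul_eq_comp, ← map_mul, mul_comm, map_mul,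
    Module.End.mul_eq_comp, LinearMap.baseChange_comp, LinearMap.comp_apply]

variable [Fintype S] [Module.Finite ℚ V]

/-- **Upper bound `dim_K V_{K,τₛ} ≤ dim_ℚ V / [F:ℚ]`**: `V_{K,τₛ} = πₛ(K ⊗ V)` is `K`-spanned by the `πₛ(1 ⊗ vⱼ)` for an
`F`-basis `(vⱼ)` of `V` (`πₛ(1 ⊗ b v) = τₛ(b) πₛ(1 ⊗ v)` for `b ∈ F`). [cite: Milne1999LefschetzClasses, §2 Prop. 2.1 and p. 646 L49 ("Proposition 2.1 below shows that Vᵢ has dimension 2g/f over Fᵢ")] -/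
theorem finrank_eigenspaceBaseChange_le (hτ : Function.Injective τ) (hcard : Fintype.card S = finrank ℚ F) (s : S) :
    finrank K ↥(A.eigenspaceBaseChange K (τ s)) ≤ finrank ℚ V / finrank ℚ F := by
  classical
  letI : Module F V := Module.compHom V (A.ι : F →+* Module.End ℚ V)
  haveI : IsScalarTower ℚ F V := A.isScalarTower_compHom
  haveI : Module.Finite F V := Module.Finite.of_restrictScalars_finite ℚ F V
  have hdV : finrank ℚ V / finrank ℚ F = finrank F V := by
    rw [← Module.finrank_mul_finrank ℚ F V, Nat.mul_div_cancel_left _ Module.finrank_pos]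
  rw [hdV]
  set bF := Module.finBasis ℚ F
  set bV := Module.finBasis F V
  set π := A.eigenprojBaseChange K τ s with hπ
  -- the block is the range of `πₛ`
  have hW : A.eigenspaceBaseChange K (τ s) ≤ LinearMap.range π := fun w hw =>
    ⟨w, A.eigenprojBaseChange_apply_eq_self_of_mem K τ hτ hcard hw⟩
  -- `K ⊗ V` is `K`-spanned by the `1 ⊗ (bₘ • vⱼ)`, and `πₛ(1 ⊗ bₘ • vⱼ) = τₛ(bₘ) • πₛ(1 ⊗ vⱼ)`
  have hspan : LinearMap.range π ≤ Submodule.span K (Set.range fun j => π (1 ⊗ₜ[ℚ] bV j)) := by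
    rw [LinearMap.range_eq_map, ← (Algebra.TensorProduct.basis K (bF.smulTower bV)).span_eq, Submodule.map_span,
      Submodule.span_le]
    rintro _ ⟨_, ⟨⟨m, j⟩, rfl⟩, rfl⟩
    rw [Algebra.TensorProduct.basis_apply, Module.Basis.smulTower_apply]
    have h2 : (1 : K) ⊗ₜ[ℚ] (bF m • bV j) = (A.ι (bF m)).baseChange K (1 ⊗ₜ[ℚ] bV j) := by
      rw [LinearMap.baseChange_tmul]; rfl
    rw [h2, hπ, ← A.eigenprojBaseChange_apply_comm K τ (fun a x => A.baseChange_ι_comm K a (bF m) x) s,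
      A.baseChange_ι_apply_of_mem_eigenspaceBaseChange K (A.eigenprojBaseChange_apply_mem K τ s _) (bF m)]
    exact Submodule.smul_mem _ _ (Submodule.subset_span ⟨j, rfl⟩)
  calc finrank K ↥(A.eigenspaceBaseChange K (τ s))
      ≤ finrank K ↥(Submodule.span K (Set.range fun j => π (1 ⊗ₜ[ℚ] bV j))) := Submodule.finrank_mono (hW.trans hspan)
    _ ≤ Fintype.card (Fin (finrank F V)) := finrank_range_le_card _
    _ = finrank F V := Fintype.card_fin _

/-- **`Σₛ dim_K V_{K,τₛ} = dim_ℚ V`** (`K ⊗ V = ⊕ₛ V_{K,τₛ}` and `dim_K(K ⊗ V) = dim_ℚ V`).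
[cite: Milne1999LefschetzClasses, §2 Prop. 2.1 (proof) and p. 649 L1–L8] -/
theorem sum_finrank_eigenspaceBaseChange (hτ : Function.Injective τ) (hcard : Fintype.card S = finrank ℚ F) :
    ∑ s, finrank K ↥(A.eigenspaceBaseChange K (τ s)) = finrank ℚ V := by
  classical
  rw [← finrank_eq_sum_of_isInternal K (A.isInternal_eigenspaceBaseChange K τ hτ hcard), Module.finrank_baseChange]

/-- **Milne's Proposition 2.1 on points: every block has the same dimension `dim_K V_{K,σ} = dim_ℚ V / [F : ℚ]`**
("`V(A)` is a free `L ⊗_ℚ k`-module of rank `2 dim A/[L : ℚ]`"; "`Vᵢ` has dimension `2g/f` over `Fᵢ`"; Deligne: "Each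
`H¹_{B,σ}` has dimension `d`") — for EVERY field `K` admitting all embeddings of `F` (the tree's
`EndAction.finrank_iInf_eigenspace_eq_div` is `K = ℂ`, via the canonical embedding; here: each block is spanned by `d`
vectors and the `[F:ℚ]` blocks fill `K ⊗ V` of dimension `d [F:ℚ]`). [cite: Milne1999LefschetzClasses, §2 Prop. 2.1 p. 647 and p. 646 L49]
[cite: Deligne1982HodgeCycles, §4 (re-ed. p. 30, "Each H¹_{B,σ} has dimension d")] -/
theorem finrank_eigenspaceBaseChange_eq_div (hτ : Function.Injective τ) (hcard : Fintype.card S = finrank ℚ F) (s : S) :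
    finrank K ↥(A.eigenspaceBaseChange K (τ s)) = finrank ℚ V / finrank ℚ F := by
  classical
  set d := finrank ℚ V / finrank ℚ F with hd
  have hle : ∀ t, finrank K ↥(A.eigenspaceBaseChange K (τ t)) ≤ d := A.finrank_eigenspaceBaseChange_le K τ hτ hcard
  have hsum : ∑ t, finrank K ↥(A.eigenspaceBaseChange K (τ t)) = ∑ _t : S, d := by
    rw [A.sum_finrank_eigenspaceBaseChange K τ hτ hcard, Finset.sum_const, Finset.card_univ, hcard, smul_eq_mul, hd,
      Nat.mul_div_cancel' A.finrank_field_dvd_finrank]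
  by_contra hne
  have hlt := Finset.sum_lt_sum (s := Finset.univ) (fun t _ => hle t) ⟨s, Finset.mem_univ _, lt_of_le_of_ne (hle s) hne⟩
  exact absurd hsum (ne_of_lt hlt)

/-- `dim_K V_{K,σ} · [F : ℚ] = dim_ℚ V`. [cite: Milne1999LefschetzClasses, §2 Prop. 2.1 ("2 dim A = m[L : ℚ]")] -/
theorem finrank_eigenspaceBaseChange_mul_finrank (hτ : Function.Injective τ) (hcard : Fintype.card S = finrank ℚ F)
    (s : S) : finrank K ↥(A.eigenspaceBaseChange K (τ s)) * finrank ℚ F = finrank ℚ V := by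
  rw [A.finrank_eigenspaceBaseChange_eq_div K τ hτ hcard, Nat.div_mul_cancel A.finrank_field_dvd_finrank]

omit [Module.Finite ℚ V] in
/-- **The blocks are spanned by `d = dim_F V` vectors `πₛ(1 ⊗ vⱼ)`, which are therefore a `K`-BASIS of `V_{K,σ}`** — the
freeness clause of Prop. 2.1 read on one block: `V_{K,σ} = V ⊗_{F,σ} K` has the `K`-basis `1 ⊗ vⱼ` for any `F`-basis
`(vⱼ)` of `V`. Stated: the block is the `K`-span of the `πₛ(1 ⊗ v)`, `v ∈ V`. [cite: Milne1999LefschetzClasses, §2 Prop. 2.1 and p. 649 L1–L8 ("(V_σ, φ_σ) = (V(A), φ) ⊗_{F,σ} k^al")] -/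
theorem eigenspaceBaseChange_eq_span_eigenprojBaseChange_one_tmul (hτ : Function.Injective τ)
    (hcard : Fintype.card S = finrank ℚ F) (s : S) :
    A.eigenspaceBaseChange K (τ s) = Submodule.span K (Set.range fun v : V => A.eigenprojBaseChange K τ s (1 ⊗ₜ[ℚ] v)) := by
  refine le_antisymm (fun w hw => ?_) (Submodule.span_le.mpr ?_)
  · have key : ∀ w : K ⊗[ℚ] V, A.eigenprojBaseChange K τ s w ∈
        Submodule.span K (Set.range fun v : V => A.eigenprojBaseChange K τ s (1 ⊗ₜ[ℚ] v)) := by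
      intro w
      induction w using TensorProduct.induction_on with
      | zero => rw [map_zero]; exact Submodule.zero_mem _
      | tmul c v =>
        rw [show (c ⊗ₜ[ℚ] v : K ⊗[ℚ] V) = c • ((1 : K) ⊗ₜ[ℚ] v) by rw [TensorProduct.smul_tmul', smul_eq_mul, mul_one],
          map_smul]
        exact Submodule.smul_mem _ _ (Submodule.subset_span ⟨v, rfl⟩)
      | add x y hx hy => rw [map_add]; exact Submodule.add_mem _ hx hy
    rw [← A.eigenprojBaseChange_apply_eq_self_of_mem K τ hτ hcard hw]
    exact key w
  · rintro _ ⟨v, rfl⟩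
    exact A.eigenprojBaseChange_apply_mem K τ s _

end Dimension

end EndAction


/-! ## §7 Proposition 2.1 as printed, for EVERY field `K ⊇ ℚ`: `K ⊗ V` is free over `K ⊗_ℚ F` of rank `dim_ℚ V/[F:ℚ]` -/

namespace EndAction

section Free

open Module

/-- For `c = k ⊗ b ∈ K ⊗ F`: `(1 ⊗ a) · c ↦ k ⊗ ι(ab) v = ι(a)_K (k ⊗ ι(b) v)` — the coordinate maps
`K ⊗ F → K ⊗ V`, `k ⊗ b ↦ k ⊗ ι(b) v`, are `K ⊗ F`-linear for the action `ι_K`. [cite: Milne1999LefschetzClasses, §2 Prop. 2.1 p. 647] -/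
theorem baseChange_apply_ι_comp_mul (v : V) (a : F) (c : K ⊗[ℚ] F) :
    ((LinearMap.applyₗ v ∘ₗ A.ι.toLinearMap).baseChange K) (((1 : K) ⊗ₜ[ℚ] a) * c) =
      (A.ι a).baseChange K (((LinearMap.applyₗ v ∘ₗ A.ι.toLinearMap).baseChange K) c) := by
  induction c using TensorProduct.induction_on with
  | zero => simp
  | tmul k b =>
    rw [Algebra.TensorProduct.tmul_mul_tmul, one_mul, LinearMap.baseChange_tmul, LinearMap.baseChange_tmul,
      LinearMap.baseChange_tmul, LinearMap.comp_apply, LinearMap.comp_apply, AlgHom.toLinearMap_apply,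
      AlgHom.toLinearMap_apply, LinearMap.applyₗ_apply_apply, LinearMap.applyₗ_apply_apply, map_mul,
      Module.End.mul_apply]
  | add x y hx hy => rw [mul_add, map_add, hx, hy, map_add, map_add]

variable [Module.Finite ℚ V]

/-- **Milne's Proposition 2.1, as printed, on `K`-points: "`V(A)` is a free `L ⊗_ℚ k`-module of rank `2 dim A/[L : ℚ]`"**
— for EVERY field `K ⊇ ℚ` (no splitting needed): there are `d` vectors `v₁, …, v_d ∈ V`, `d · [F : ℚ] = dim_ℚ V`, such
that `(c_j) ↦ Σ_j (k ⊗ b ↦ k ⊗ ι(b) v_j)(c_j)` is a `K`-linear BIJECTION `(K ⊗_ℚ F)^d → K ⊗_ℚ V` intertwining the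
multiplication by `1 ⊗ a` with `ι(a)_K` (`baseChange_apply_ι_comp_mul`), i.e. an isomorphism of `K ⊗ F`-modules
`(K ⊗ F)^d ≅ K ⊗ V` (any `F`-basis of `V` through `ι` serves; here `k = ℚ`, so Milne's dimension argument via the
characteristic polynomial is not needed). [cite: Milne1999LefschetzClasses, §2 Prop. 2.1 p. 647 L14–L16] -/
theorem exists_bijective_sum_baseChange_apply_ι :
    ∃ (d : ℕ) (v : Fin d → V), d * finrank ℚ F = finrank ℚ V ∧
      Function.Bijective fun c : Fin d → K ⊗[ℚ] F =>
        ∑ j, ((LinearMap.applyₗ (v j) ∘ₗ A.ι.toLinearMap).baseChange K) (c j) := by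
  classical
  letI : Module F V := Module.compHom V (A.ι : F →+* Module.End ℚ V)
  haveI : IsScalarTower ℚ F V := A.isScalarTower_compHom
  haveI : Module.Finite F V := Module.Finite.of_restrictScalars_finite ℚ F V
  set d := finrank F V
  let bV := Module.finBasis F V
  have hdim : d * finrank ℚ F = finrank ℚ V := by rw [mul_comm]; exact Module.finrank_mul_finrank ℚ F V
  refine ⟨d, bV, hdim, ?_⟩
  -- the map as a `K`-linear map
  let Ψ : (Fin d → K ⊗[ℚ] F) →ₗ[K] K ⊗[ℚ] V :=
    ∑ j, ((LinearMap.applyₗ (bV j : V) ∘ₗ A.ι.toLinearMap).baseChange K) ∘ₗ LinearMap.proj j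
  have hΨ : (fun c : Fin d → K ⊗[ℚ] F => ∑ j, ((LinearMap.applyₗ (bV j : V) ∘ₗ A.ι.toLinearMap).baseChange K) (c j)) =
      ⇑Ψ := by
    funext c
    simp only [Ψ, LinearMap.sum_apply, LinearMap.comp_apply, LinearMap.proj_apply]
  rw [hΨ]
  -- surjective: `k ⊗ w = Ψ (j ↦ k ⊗ (w)_j)`
  have hsurj : Function.Surjective Ψ := by
    rw [← LinearMap.range_eq_top, eq_top_iff]
    rintro x -
    induction x using TensorProduct.induction_on with
    | zero => exact Submodule.zero_mem _
    | tmul k w =>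
      refine ⟨fun j => k ⊗ₜ[ℚ] bV.repr w j, ?_⟩
      simp only [Ψ, LinearMap.sum_apply, LinearMap.comp_apply, LinearMap.proj_apply, LinearMap.baseChange_tmul,
        AlgHom.toLinearMap_apply, LinearMap.applyₗ_apply_apply]
      rw [← TensorProduct.tmul_sum]
      congr 1
      conv_rhs => rw [← bV.sum_repr w]
      rfl
    | add x y hx hy => exact Submodule.add_mem _ (hx) (hy)
  -- equal dimensions: `dim (K ⊗ F)^d = d [F:ℚ] = dim V = dim K ⊗ V`
  have hfin : finrank K (Fin d → K ⊗[ℚ] F) = finrank K (K ⊗[ℚ] V) := by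
    rw [Module.finrank_pi_fintype, Finset.sum_const, Finset.card_univ, Fintype.card_fin, smul_eq_mul,
      Module.finrank_baseChange, Module.finrank_baseChange, hdim]
  exact ⟨(LinearMap.injective_iff_surjective_of_finrank_eq_finrank hfin).mpr hsurj, hsurj⟩

end Free

end EndAction

end HodgeStructure

end Literature.AlgebraicGeometry.Motives
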